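import Literature.MathematicalPhysics.QuantumFieldTheory.O2ThreeScalarCrossing

/-!
# The `{t, s}` rows of the `O(2)` three-scalar crossing system are the KPSV `{φ_i, s}` system at `N = 2`
# (Chester–Landry–Liu–Poland–Simmons-Duffin–Su–Vichi 2020, §2.1 and appendices; Kos–Poland–Simmons-Duffin–Vichi
# 2015, §2.1)

Topic `MathematicalPhysics/QuantumFieldTheory`; theorems only (no named fact, no definition beyond two index
tables, no instance, no `sorry`).  A leaf sequel of `O2ThreeScalarCrossing.lean`, whose 22 quoted rows
`V⃗_{0⁺}, V⃗_{0⁻}, V⃗_{1}, V⃗_{2,ℓ⁺}, V⃗_{2,ℓ⁻}, V⃗_{3}, V⃗_{4}` [ChesterEtAl2020, App. «Crossing vectors»] it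
imports unchanged.  That file checks the seven rows of the correlators of `φ` and `s` alone against the
independently DERIVED seven-equation system of [KosPolandSimmonsDuffinVichi2015] (`ONMixedSumRule.lean`,
`systemCrossingAt_iff`) — `quad0p_kpsv`, `quad2p_kpsv`, `quad0m_kpsv`, `quad1_kpsv`.  This file does the same
for the seven rows of the correlators of `t` and `s` alone, which that file leaves quoted.

SOURCE (read from the held text `paper:arxiv-1912.03324`, §2.1 p. 6–7, App. «Tensor structures» p. 20,
App. «Crossing vectors» p. 21–22).  S. M. Chester, W. Landry, J. Liu, D. Poland, D. Simmons-Duffin, N. Su,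
A. Vichi, *Carving out OPE space and precise O(2) model critical exponents*, JHEP 06 (2020) 142:
* §2.1: *"Tensor products of these irreps are given by `q₁ ⊗ q₂ = (q₁+q₂) ⊕ |q₁−q₂|`,
  `q ⊗ q = (2q)_s ⊕ 0⁺_s ⊕ 0⁻_a`, `0^± ⊗ q = q`, `0^± ⊗ 0^± = 0⁺_s`, `0^± ⊗ 0^∓ = 0⁻`, where `s/a` denotes the
  symmetric/antisymmetric part of the tensor product, in the case of identical irreps"*; the block expansion
  *"`Σ_𝒪 (−1)^ℓ λ_{𝒪₁𝒪₂𝒪} λ_{𝒪₃𝒪₄𝒪} T^{R}_{ℛ₁ℛ₂ℛ₃ℛ₄}(y_i) g^{Δ₁₂,Δ₃₄}_{Δ,ℓ}(u,v)`"*; *"If `𝒪¹ = 𝒪²` (or `𝒪³ = 𝒪⁴`),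
  then Bose symmetry requires that `𝒪` have only even/odd `ℓ` for `R` in the symmetric/antisymmetric product"*;
  *"The singlet `S`, traceless symmetric `T`, vector `V` and antisymmetric `A` irreps considered in previous
  `O(N)` bootstrap papers correspond for `O(2)` to the `0⁺`, `2`, `1`, and `0⁻` irreps, respectively"*
  [cite: ChesterEtAl2020, §2.1].
* App. «Tensor structures», in the variables `w_i = y_i·e`, `w̄_i = y_i·ē` with `w_i w̄_i = 0`:
  `⟨φφφφ⟩: T^{0⁺} = (w_iw̄_j + w̄_iw_j)(w_kw̄_l + w̄_kw_l)`, `T^{0⁻} = −(w_iw̄_j − w̄_iw_j)(w_kw̄_l − w̄_kw_l)`,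
  `T^{2} = w_iw_jw̄_kw̄_l + w̄_iw̄_jw_kw_l`; `⟨tttt⟩: T^{0⁺} = (w_iw̄_j + w̄_iw_j)²(w_kw̄_l + w̄_kw_l)²`,
  `T^{0⁻} = −(w_i²w̄_j² − w̄_i²w_j²)(w_k²w̄_l² − w̄_k²w_l²)`, `T^{4} = (w_iw_jw̄_kw̄_l + w̄_iw̄_jw_kw_l)²`;
  `⟨φsφs⟩, ⟨sφφs⟩: T^{1} = w_iw̄_k + w̄_iw_k`; `⟨tsts⟩, ⟨stts⟩: T^{2} = w_i²w̄_k² + w̄_i²w_k²`;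
  `⟨ttss⟩: T^{0⁺} = (w_iw̄_j + w̄_iw_j)²`; `⟨φφss⟩: T^{0⁺} = w_iw̄_j + w̄_iw_j` [cite: ChesterEtAl2020, App. «Tensor structures»].
  Since `w_i w̄_i = 0`, every `{t, s}` structure is the corresponding `{φ, s}` structure under `w_i ↦ w_i²`,
  `w̄_i ↦ w̄_i²` (charge doubling), with `2 ↦ 4` as the exchanged non-singlet irrep and the same Bose parities
  (`4_s, 0⁺_s` even, `0⁻_a` odd; `t × s = 2` of either spin parity as `φ × s = 1`).  Hence the crossing equations
  of `⟨tttt⟩, ⟨ttss⟩, ⟨tsts⟩, ⟨ssss⟩` must be those of `⟨φφφφ⟩, ⟨φφss⟩, ⟨φsφs⟩, ⟨ssss⟩` under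
  `(φ, Δ_φ; sectors 0⁺, 2⁺, 0⁻, 1) ↦ (t, Δ_t; sectors 0⁺, 4, 0⁻, 2^±)` — i.e. again the KPSV system at `N = 2`.
F. Kos, D. Poland, D. Simmons-Duffin, A. Vichi, *Bootstrapping the O(N) archipelago*, JHEP 11 (2015) 106, §2.1:
the seven equations and `V⃗_S, V⃗_T, V⃗_A, V⃗_V` (`ONMixedSumRule.lean`: `quadVS`, `V7T`, `V7A`, `V7V`)
[cite: KosPolandSimmonsDuffinVichi2015, §2.1].

WHAT IS PROVED (pure finite-dimensional algebra over opaque channel functions, as in the imported files).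
The seven `{t, s}` rows are rows `5, 4, 6, 13, 15, 16, 17` (1-based; `tsRow`, in the order of the seven KPSV
equations; row 13, `⟨ssss⟩`, is shared with the `{φ, s}` rows `2, 1, 3, 13, 14, 18, 19` = `kpsvRow`).  On them:
(1) the `0⁺` summand is `kpsvMul ·` the KPSV singlet summand with `(λ_{φφ𝒪}, λ_{ss𝒪}, Δφ) ↦ (λ_{tt𝒪}, λ_{ss𝒪}, Δt)`
and does not see `λ_{φφ𝒪}` (`quad0p_kpsv_ts`); (2) the charge-`4` summand is `kpsvMul · ½ · λ²_{tt𝒪} V⃗_T|_{N=2}`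
(`quad4_kpsv_ts`); (3) the `0⁻` summand is `kpsvMul · (−1) · λ²_{tt𝒪} V⃗_A` and does not see `λ_{φφ𝒪}`
(`quad0m_kpsv_ts`); (4) the charge-`2` summands of even and of odd spin are `kpsvMul · ε · λ²_{ts𝒪} V⃗_V[ε]` with
`ε = +1` (`quad2p_kpsv_ts`, which does not see `λ_{φφ𝒪}`) and `ε = −1` (`quad2m_kpsv_ts`); (5) the sectors `1`
and `3` vanish there (`quad1_ts`, `V3_ts`), and, completing the `{φ, s}` check of the imported file, the sectors
`2⁻, 3, 4` vanish on `kpsvRow` (`V2m_kpsv`, `V3_kpsv`, `V4_kpsv`); (6) bookkeeping: the two row sets are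
injective images of `Fin 7` meeting in row 13 only, and the rows in neither are exactly rows `7–12` (the
`⟨ttφφ⟩, ⟨tφtφ⟩, ⟨φttφ⟩` group) and `20–22` (the `⟨φφst⟩, ⟨φsφt⟩, ⟨sφφt⟩` group) (`uncheckedRows_eq`).
The multipliers `kpsvMul = (4, 2, −2, 2, 2, 2, 2)` and the weights `1, ½, −1, ε` are THE SAME as for the `{φ, s}`
rows — so 13 of the 22 quoted rows (every entry of every vector on rows `1–6, 13–19`) now agree with an
independently derived system up to one fixed dictionary; the nine rows of the two correlator groups that involve
`φ` and `t` together remain quoted.  Only the algebraic identities are asserted; the charge-doubling remark above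
is commentary explaining why they had to hold.

What is NOT here: a derivation of any row from `O(2)` crossing symmetry (in particular of rows `7–12, 20–22`);
anything about spectra, functionals or numerics (all in the imported files and their sequels).

## References
* S. M. Chester, W. Landry, J. Liu, D. Poland, D. Simmons-Duffin, N. Su, A. Vichi, *Carving out OPE space and
  precise O(2) model critical exponents*, JHEP 06 (2020) 142, arXiv:1912.03324, §2.1, App. «Tensor structures»,
  App. «Crossing vectors». [cite: ChesterEtAl2020]
* F. Kos, D. Poland, D. Simmons-Duffin, A. Vichi, *Bootstrapping the O(N) archipelago*, JHEP 11 (2015) 106,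
  arXiv:1504.07997, §2.1. [cite: KosPolandSimmonsDuffinVichi2015]
-/

noncomputable section

open Finset Matrix
open Literature.MathematicalPhysics.QuantumFieldTheory.ONVectorSumRule
open Literature.MathematicalPhysics.QuantumFieldTheory.ONMixedSumRule
open Literature.MathematicalPhysics.QuantumFieldTheory.O2ThreeScalarCrossing

namespace Literature.MathematicalPhysics.QuantumFieldTheory.O2ThreeScalarCrossingTS

/-! ## 1. The seven `{t, s}` rows -/

/-- The positions (0-based) of the seven `{t, s}` rows among the 22 rows, in the order of the seven KPSV
equations: `(5, 4, 6, 13, 15, 16, 17)` (1-based) — three rows of `⟨tttt⟩`, then `⟨ssss⟩`, `⟨tsts⟩`, `⟨ttss⟩_∓`.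
[cite: ChesterEtAl2020, §2.1 (dictionary `S, T, V, A ↔ 0⁺, 2, 1, 0⁻`; `q ⊗ q = (2q)_s ⊕ 0⁺_s ⊕ 0⁻_a`)] -/
def tsRow : Fin 7 → Fin 22 := ![4, 3, 5, 12, 14, 15, 16]

/-- `0⁺ ↔ S`: on the seven `{t, s}` rows the `0⁺` summand `(λ_{ss𝒪} λ_{φφ𝒪} λ_{tt𝒪}) V⃗_{0⁺}[g] (…)ᵀ` is
`kpsvMul ·` the KPSV singlet summand `(λ_{tt𝒪} λ_{ss𝒪}) V⃗_S[g₀] (λ_{tt𝒪}; λ_{ss𝒪})` with exponents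
`Δt, Δs, (Δt+Δs)/2`, for a block family whose `tttt`, `ssss`, `ttss` members are `g₀`; `λ_{φφ𝒪} = b` does not
enter. [cite: ChesterEtAl2020, App. «Crossing vectors» (`V⃗_{0⁺,Δ,ℓ⁺}`, rows 4–6, 13, 15–17)]
[cite: KosPolandSimmonsDuffinVichi2015, §2.1 (`V⃗_S`)] -/
theorem quad0p_kpsv_ts (D : Dims) (a b c : ℝ) {g : Label → ℝ → ℝ → ℝ} {g₀ : ℝ → ℝ → ℝ}
    (h₁ : g .tttt = g₀) (h₂ : g .ssss = g₀) (h₃ : g .ttss = g₀) (u v : ℝ) (k : Fin 7) :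
    quad0p D a b c g u v (tsRow k) = kpsvMul k * quadVS D.Δt D.Δs c a g₀ u v k := by
  have hx : (D.Δs + D.Δt) / 2 = (D.Δt + D.Δs) / 2 := by ring
  rw [quad0p_eq, quadVS_eq]
  fin_cases k <;> simp only [tsRow, kpsvMul, Matrix.cons_val_zero', Matrix.cons_val_succ', Matrix.cons_val] <;>
    simp [Fminus, Fplus, Dims.expo, h₁, h₂, h₃, hx] <;> ring

/-- `4 ↔ T`: on the seven `{t, s}` rows the charge-`4` summand `λ²_{tt𝒪} V⃗_{4}[g]` is `kpsvMul · ½ ·` the KPSV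
summand `λ²_{tt𝒪} V⃗_T|_{N=2}[g₀]` at exponent `Δt` (whose second entry `(1 − 2/N) F−` vanishes at `N = 2`, as
row 4 of `V⃗_4` does). [cite: ChesterEtAl2020, App. «Crossing vectors» (`V⃗_{4,Δ,ℓ⁺}`, rows 5, 6)]
[cite: KosPolandSimmonsDuffinVichi2015, §2.1 (`V⃗_T`)] -/
theorem quad4_kpsv_ts (D : Dims) (c : ℝ) {g : Label → ℝ → ℝ → ℝ} {g₀ : ℝ → ℝ → ℝ} (h₁ : g .tttt = g₀)
    (u v : ℝ) (k : Fin 7) :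
    c ^ 2 * V4 D g u v (tsRow k) = kpsvMul k * (1 / 2) * (c ^ 2 * V7T 2 D.Δt g₀ u v k) := by
  fin_cases k <;> simp only [tsRow, kpsvMul, Matrix.cons_val_zero', Matrix.cons_val_succ'] <;>
    simp [V4, V7T, Fminus, Fplus, Dims.expo, h₁] <;> ring

/-- `0⁻ ↔ A`: on the seven `{t, s}` rows the `0⁻` summand `(λ_{φφ𝒪} λ_{tt𝒪}) V⃗_{0⁻}[g] (…)ᵀ` is
`kpsvMul · (−1) ·` the KPSV summand `λ²_{tt𝒪} V⃗_A[g₀]` at exponent `Δt` (sign: `0⁻` spins are odd, `(−1)^ℓ = −1`);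
`λ_{φφ𝒪} = b` does not enter. [cite: ChesterEtAl2020, App. «Crossing vectors» (`V⃗_{0⁻,Δ,ℓ⁻}`, rows 4–6)]
[cite: KosPolandSimmonsDuffinVichi2015, §2.1 (`V⃗_A`)] -/
theorem quad0m_kpsv_ts (D : Dims) (b c : ℝ) {g : Label → ℝ → ℝ → ℝ} {g₀ : ℝ → ℝ → ℝ} (h₁ : g .tttt = g₀)
    (u v : ℝ) (k : Fin 7) :
    quad0m D b c g u v (tsRow k) = kpsvMul k * (-(c ^ 2 * V7A D.Δt g₀ u v k)) := by
  rw [quad0m_eq]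
  fin_cases k <;> simp only [tsRow, kpsvMul, Matrix.cons_val_zero', Matrix.cons_val_succ', Matrix.cons_val] <;>
    simp [V7A, Fminus, Fplus, Dims.expo, h₁] <;> ring

/-- `2⁺ ↔ V (even spin)`: on the seven `{t, s}` rows the charge-`2` even-spin summand
`(λ_{φφ𝒪} λ_{ts𝒪}) V⃗_{2,ℓ⁺}[g] (…)ᵀ` is `kpsvMul · ε ·` the KPSV summand `λ²_{ts𝒪} V⃗_V[ε; g₁, g₂]` with `ε = 1`,
`g₁ = g^{ts,ts}` (exponent `(Δt+Δs)/2`), `g₂ = g^{st,ts}` (exponent `Δt`); `λ_{φφ𝒪} = b` does not enter.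
[cite: ChesterEtAl2020, App. «Crossing vectors» (`V⃗_{2,Δ,ℓ⁺}`, rows 15–17)]
[cite: KosPolandSimmonsDuffinVichi2015, §2.1 (`V⃗_V`)] -/
theorem quad2p_kpsv_ts (D : Dims) (b z : ℝ) (g : Label → ℝ → ℝ → ℝ) (u v : ℝ) (k : Fin 7) :
    quad2p D b z g u v (tsRow k) =
      kpsvMul k * (1 * (z ^ 2 * V7V D.Δt D.Δs 1 (g .tsts) (g .stts) u v k)) := by
  have hx : (D.Δs + D.Δt) / 2 = (D.Δt + D.Δs) / 2 := by ring
  rw [quad2p_eq]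
  fin_cases k <;> simp only [tsRow, kpsvMul, Matrix.cons_val_zero', Matrix.cons_val_succ', Matrix.cons_val] <;>
    simp [V7V, Fminus, Fplus, Dims.expo, hx] <;> ring

/-- `2⁻ ↔ V (odd spin)`: on the seven `{t, s}` rows the charge-`2` odd-spin summand `λ²_{ts𝒪} V⃗_{2,ℓ⁻}[g]` is
`kpsvMul · ε ·` the KPSV summand `λ²_{ts𝒪} V⃗_V[ε; g₁, g₂]` with `ε = −1` (same `g₁, g₂` as for even spin).
[cite: ChesterEtAl2020, App. «Crossing vectors» (`V⃗_{2,Δ,ℓ⁻}`, rows 15–17)]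
[cite: KosPolandSimmonsDuffinVichi2015, §2.1 (`V⃗_V`)] -/
theorem quad2m_kpsv_ts (D : Dims) (z : ℝ) (g : Label → ℝ → ℝ → ℝ) (u v : ℝ) (k : Fin 7) :
    z ^ 2 * V2m D g u v (tsRow k) =
      kpsvMul k * (-1 * (z ^ 2 * V7V D.Δt D.Δs (-1) (g .tsts) (g .stts) u v k)) := by
  have hx : (D.Δs + D.Δt) / 2 = (D.Δt + D.Δs) / 2 := by ring
  fin_cases k <;> simp only [tsRow, kpsvMul, Matrix.cons_val_zero', Matrix.cons_val_succ'] <;>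
    simp [V2m, V7V, Fminus, Fplus, Dims.expo, hx] <;> ring

/-! ## 2. The sectors that do not enter -/

/-- The charge-`1` summand vanishes on the `{t, s}` rows (no `φ` among the externals).
[cite: ChesterEtAl2020, App. «Crossing vectors» (`V⃗_{1,Δ,ℓ}`, rows 4–6, 13, 15–17 are `0`)] -/
theorem quad1_ts (D : Dims) (x y ε : ℝ) (g : Label → ℝ → ℝ → ℝ) (u v : ℝ) (k : Fin 7) :
    quad1 D x y ε g u v (tsRow k) = 0 := by
  rw [quad1_eq]
  fin_cases k <;> simp [tsRow]

/-- The charge-`3` vector vanishes on the `{t, s}` rows.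
[cite: ChesterEtAl2020, App. «Crossing vectors» (`V⃗_{3,Δ,ℓ}`, rows 4–6, 13, 15–17 are `0`)] -/
theorem V3_ts (D : Dims) (ε : ℝ) (g : Label → ℝ → ℝ → ℝ) (u v : ℝ) (k : Fin 7) :
    V3 D ε g u v (tsRow k) = 0 := by
  fin_cases k <;> simp [V3, tsRow]

/-- The charge-`2` odd-spin vector vanishes on the `{φ, s}` rows `kpsvRow`.
[cite: ChesterEtAl2020, App. «Crossing vectors» (`V⃗_{2,Δ,ℓ⁻}`, rows 1–3, 13, 14, 18, 19 are `0`)] -/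
theorem V2m_kpsv (D : Dims) (g : Label → ℝ → ℝ → ℝ) (u v : ℝ) (k : Fin 7) :
    V2m D g u v (kpsvRow k) = 0 := by
  fin_cases k <;> simp [V2m, kpsvRow]

/-- The charge-`3` vector vanishes on the `{φ, s}` rows `kpsvRow`.
[cite: ChesterEtAl2020, App. «Crossing vectors» (`V⃗_{3,Δ,ℓ}`, rows 1–3, 13, 14, 18, 19 are `0`)] -/
theorem V3_kpsv (D : Dims) (ε : ℝ) (g : Label → ℝ → ℝ → ℝ) (u v : ℝ) (k : Fin 7) :
    V3 D ε g u v (kpsvRow k) = 0 := by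
  fin_cases k <;> simp [V3, kpsvRow]

/-- The charge-`4` vector vanishes on the `{φ, s}` rows `kpsvRow`.
[cite: ChesterEtAl2020, App. «Crossing vectors» (`V⃗_{4,Δ,ℓ⁺}`, rows 1–3, 13, 14, 18, 19 are `0`)] -/
theorem V4_kpsv (D : Dims) (g : Label → ℝ → ℝ → ℝ) (u v : ℝ) (k : Fin 7) :
    V4 D g u v (kpsvRow k) = 0 := by
  fin_cases k <;> simp [V4, kpsvRow]

/-! ## 3. Bookkeeping: which rows are now checked -/

/-- `tsRow` lists seven distinct rows. [cite: ChesterEtAl2020, App. «Crossing vectors» (22 rows)] -/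
theorem tsRow_injective : Function.Injective tsRow := by decide

/-- `kpsvRow` lists seven distinct rows. [cite: ChesterEtAl2020, App. «Crossing vectors» (22 rows)] -/
theorem kpsvRow_injective : Function.Injective kpsvRow := by decide

/-- The `{φ, s}` rows and the `{t, s}` rows share exactly row 13 (`⟨ssss⟩`; 0-based `12`).
[cite: ChesterEtAl2020, App. «Crossing vectors» (row 13)] -/
theorem kpsvRow_inter_tsRow :
    Finset.univ.image kpsvRow ∩ Finset.univ.image tsRow = ({12} : Finset (Fin 22)) := by decide

/-- The rows in neither set are rows `7–12` and `20–22` (0-based `6–11`, `19–21`): the `⟨ttφφ⟩, ⟨tφtφ⟩, ⟨φttφ⟩`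
group and the `⟨φφst⟩, ⟨φsφt⟩, ⟨sφφt⟩` group, the only correlators involving `φ` and `t` together.
[cite: ChesterEtAl2020, App. «Crossing vectors» (rows 7–12, 20–22)] -/
theorem uncheckedRows_eq :
    (Finset.univ.image kpsvRow ∪ Finset.univ.image tsRow)ᶜ =
      ({6, 7, 8, 9, 10, 11, 19, 20, 21} : Finset (Fin 22)) := by decide

end Literature.MathematicalPhysics.QuantumFieldTheory.O2ThreeScalarCrossingTS

end
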